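import Summits.BirchSwinnertonDyer.BirchSwinnertonDyer.Theorems.ByReductionTypeAtTwoTorsionEulerCharH46LevelZeroInputs
import Literature.NumberTheory.EllipticCurves.IwasawaTwistModPShapiroConj
import Literature.Algebra.Homology.DiscreteRepGaloisCorollaries
import HarnessLib

set_option linter.dupNamespace false -- `…BirchSwinnertonDyer.BirchSwinnertonDyer…` is the cell's nested layout (D-0017)
set_option autoImplicit false

/-!
# H46 kernel programme (road C′), socket (HB6) at LEVEL ZERO: the reduced corestriction of a ♭-dual class vanishes

Cell `bsd-2adic` (run/shared/lean/pub/bsd-2adic/), seat `bsd-2adic-tower-1` GEN 35; `--supports stmt-BirchSwinnertonDyer-19271`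
(helper, item `OrdKatoHalfAtTwo`, TOWER road). THEOREMS ONLY (no definition, no named fact, no instance, no `sorry`); closes no item;
nothing booked; BSD is not proved by any of this.

GEN 34 (B6a, `TorsionEulerChar.H46Obstruction.canonical_cupProduct_incl_eq_zero_of_cores_reduce_eq_zero`, p735807) reduced the socket
(HB6) of `TorsionEulerChar.H46Assembly.exists_realiser_of_sockets` (p735305) — orthogonality at `v₀` of the local class `zt = ι_* zt_j`
against the corestriction of every ♭-dual class `b ∈ H¹(Γ_n, E[p^N])` — to the vanishing of the REDUCED corestriction
`cor (r_* b) = 0 ∈ H¹(Γ_ℚ, E[p^j])` (`r : E[p^N] → E[p^j]` multiplication by `p^{N-j}`).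

**Main theorem** `exists_cores_reduce_eq_zero` (level `n = 0`, `Γ_0 = κ⁻¹(p⁰ ℤ_p) = Γ_ℚ`): for `E/ℚ` with good ORDINARY reduction at `p`,
`κ` the cyclotomic `ℤ_p`-extension, `Sel_{p^∞}(E/ℚ)` FINITE, `S ⊇ {bad places} ∪ {p}`, `v₀ ∉ S`, and the hypothesis

  (T₁) no non-zero `Γ_ℚ`-invariant `p`-power torsion point of `E(ℚ̄)` maps into the kernel of reduction `E₁(ℚ̄_p)`
       (`E(ℚ)[p^∞] ∩ E₁(ℚ_p) = 0`; automatic for `p` odd since `Ê(pℤ_p)` is torsion free, [cite: SilvermanAEC2009, Thm. IV.6.1, Prop. VII.3.1]),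

there is `c` such that for all `j`, all `N ≥ c + j`, every `b ∈ H¹(Γ_0, E[p^N])` whose Shapiro lift is unramified outside `S ∪ {v₀}` and
which is Greenberg-STRICT at `p` (`b ∈ (C_p[p^N]).strictKer Γ_0`, `C_p = E[p^∞] ∩ E₁`), and every equivariant `r : E[p^N] → E[p^j]` with
values `p^{N-j} P`: `cor_{Γ_0}^{Γ_ℚ} (r_* b) = 0` — indeed already `r_* b = 0 ∈ H¹(Γ_0, E[p^j])`.

Proof (cocycle level; `g` a cocycle of `b`). (1) `…H46LevelZeroInputs.exists_pow_nsmul_push_eq_zero`: `p^m • push b = 0` in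
`H¹(Γ_0, E[p^∞])`, i.e. `p^m g(σ) = σQ − Q` for a `Q ∈ E[p^∞]`. (2) Strictness at `p`: `g(τ) ≡ τ m_N − m_N (mod C_p[p^N])` on the
decomposition group, `m_N ∈ E[p^N]`; hence `R := Q − p^m m_N` is `Γ_{ℚ_p}`-invariant modulo `E₁(ℚ̄_p)`, so `p^{j₀} R ∈ E₁`
(`exists_pow_nsmul_mem_localKernelOfReduction_of_forall_smul_sub_mem`). (3) `P := p^{N-m} Q` is `Γ_ℚ`-invariant (`p^N g = 0`) and
`P ≡ p^{N-m} R ∈ E₁` locally (`p^N m_N = 0`, `N - m ≥ j₀`), so `P = 0` by (T₁). (4) `r_* b` is the class of `p^{N-j} g = ∂(p^{N-j-m} Q)` and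
`p^{N-j-m} Q ∈ E[p^j]` because `p^{N-m} Q = 0`: the class is `0`. No universal norms, no control beyond level `0`, no corank theory.
[cite: GreenbergLNM1716, §2 Props. 2.1–2.4 (pp. 70–80), §4 Lemma 4.6 (p. 105)] [cite: SilvermanAEC2009, Prop. VII.2.1, Prop. VII.3.1]
-/

noncomputable section

open scoped Classical NumberField ContRepresentation

namespace Summit.BirchSwinnertonDyer.BirchSwinnertonDyer.Theorems

namespace TorsionEulerChar.H46LevelZero

open CategoryTheory Field NumberField IsDedekindDomain WeierstrassCurve
  Literature.NumberTheory.EllipticCurves Literature.NumberTheory.EllipticCurves.CyclotomicLayer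
  Literature.NumberTheory.EllipticCurves.GreenbergSelmer
  Literature.NumberTheory.GaloisRepresentations Literature.NumberTheory.GaloisRepresentations.DiscreteGaloisModule
  Literature.NumberTheory.GaloisCohomology ZpExtension
open _root_.TopRep _root_.ContinuousCohomology
open Literature.Algebra.Homology.DiscreteRep (toTopRepHom)

/-! ## §1 Cocycle-level lemmas over a number field -/

section Cocycle

variable {K : Type} [Field K] [NumberField K] (W : WeierstrassCurve K) (p : ℕ) [hp : Fact p.Prime]
  (H : Subgroup (absoluteGaloisGroup K)) (N : ℕ)

omit [NumberField K] hp in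
/-- **`c • push [g] = 0` ⟹ `c g` is principal in `E[p^∞]`**: if the push-forward of the class of a cocycle `g : H → E[n]` to
`H¹(H, E[p^∞])` (along `E[n] ≤ E[p^∞]`) is killed by `c`, there is `Q ∈ E[p^∞]` with `c g(σ) = σ Q − Q` for all `σ ∈ H` (as points of `E(K̄)`).
[cite: SerreGaloisCohomology1997, I §2.2, §5.1] -/
theorem exists_eq_smul_sub_of_nsmul_push_eq_zero {n : ℤ} (hle : W.geomTorsion n ≤ W.geomPrimaryTorsion p) (c : ℕ)
    (g : contOneCocycles (discreteTopRep H (W.geomTorsion n)))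
    (hg : c • resH1Hom (N := W.geomPrimaryTorsion p) (subgroupInclusion (le_refl H)) (AddSubgroup.inclusion hle) (fun _ _ ↦ rfl)
        (oneCocycleClass _ g) = 0) :
    ∃ Q : W.geomPrimaryTorsion p, ∀ σ : H,
      ((c : ℕ) : ℤ) • ((g.1 σ : W.geomTorsion n) : W.geomPoints) =
        (σ : absoluteGaloisGroup K) • (Q : W.geomPoints) - (Q : W.geomPoints) := by
  have hg' : c • oneCocycleClass (discreteTopRep H (W.geomPrimaryTorsion p))
      (contOneCocycles.pullback (subgroupInclusion (le_refl H))
        (resHomOfEquivariant (subgroupInclusion (le_refl H)) (AddSubgroup.inclusion hle) (fun _ _ ↦ rfl)) g) =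
      (0 : ↥(continuousCohomology 1 (discreteTopRep H (W.geomPrimaryTorsion p)))) := by
    rw [← resH1Hom_oneCocycleClass]; exact hg
  rw [← Nat.cast_smul_eq_nsmul ℤ, ← oneCocycleClass_smul, oneCocycleClass_eq_zero_iff] at hg'
  obtain ⟨Q, hQ⟩ := hg'
  refine ⟨Q, fun σ ↦ ?_⟩
  have e : ((c : ℕ) : ℤ) • AddSubgroup.inclusion hle (g.1 (subgroupInclusion (le_refl H) σ)) = σ • Q - Q := hQ σ
  have hσ : subgroupInclusion (le_refl H) σ = σ := Subtype.ext rfl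
  rw [hσ] at e
  have e' := congrArg (fun P : W.geomPrimaryTorsion p ↦ (P : W.geomPoints)) e
  simpa only [AddSubgroupClass.coe_zsmul, AddSubgroup.coe_inclusion, AddSubgroupClass.coe_sub, Subgroup.smul_def,
    Literature.NumberTheory.EllipticCurves.primaryComponent.coe_smul] using e'

omit hp in
/-- **Strict at `v` on cocycles**: if the class of `g : H → E[p^N]` lies in the strict kernel of Greenberg's datum `C_v[p^N]`, there is
`m_N ∈ E[p^N]` such that for every `τ ∈ Γ_{K_v}` whose image `res τ` lies in `H`,
`g(res τ) − (res τ • m_N − m_N)` maps into the kernel of reduction `E₁(K̄_v)`. [cite: Greenberg1989, §1 p. 98] [cite: GreenbergLNM1716, §2 p. 73] -/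
theorem exists_sub_mem_localKernelOfReduction_of_mem_strictKer (v : HeightOneSpectrum (𝓞 K))
    (g : contOneCocycles (discreteTopRep H (W.geomTorsion ((p ^ N : ℕ) : ℤ))))
    (hg : oneCocycleClass _ g ∈ (W.kernelOfReductionLocalDatumTorsion ((p ^ N : ℕ) : ℤ) v).strictKer H) :
    ∃ mN : W.geomTorsion ((p ^ N : ℕ) : ℤ), ∀ (τ : absoluteGaloisGroup (v.adicCompletion K))
      (hτ : absGaloisRestrict K (v.adicCompletion K) τ ∈ H),
      pointsMap W (v.adicCompletion K)
        ((g.1 ⟨absGaloisRestrict K (v.adicCompletion K) τ, hτ⟩ -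
          (absGaloisRestrict K (v.adicCompletion K) τ • mN - mN) : W.geomTorsion ((p ^ N : ℕ) : ℤ)) : W.geomPoints) ∈
        W.localKernelOfReduction v := by
  obtain ⟨q, hq⟩ := (mem_strictKer_iff_exists_gr H _ (W.kernelOfReductionLocalDatumTorsion ((p ^ N : ℕ) : ℤ) v) g).1 hg
  obtain ⟨mN, rfl⟩ := (W.kernelOfReductionLocalDatumTorsion ((p ^ N : ℕ) : ℤ) v).grMk_surjective q
  refine ⟨mN, fun τ hτ ↦ ?_⟩
  let x : decompIn H v := ⟨⟨absGaloisRestrict K (v.adicCompletion K) τ, ⟨τ, rfl⟩⟩, (mem_decompIn_iff H v _).2 hτ⟩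
  have h := hq x
  rw [Subgroup.smul_def, LocalDatum.smul_grMk, ← map_sub, ← sub_eq_zero, ← map_sub, ← AddMonoidHom.mem_ker,
    LocalDatum.ker_grMk, WeierstrassCurve.mem_kernelOfReductionLocalDatumTorsion_plus_iff] at h
  exact h

end Cocycle

/-! ## §2 The main theorem at level zero -/

section Main

variable (W : WeierstrassCurve ℚ) [W.IsElliptic] [W.IsGloballyMinimal] (p : ℕ) [hp : Fact p.Prime] (κ : ZpExtension ℚ p)
  (hκ : κ.IsCyclotomic) (hord : IsOrdinaryAt W p) (S : Finset (HeightOneSpectrum (𝓞 ℚ)))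
  (hS : ∀ v : HeightOneSpectrum (𝓞 ℚ), v ∉ S → ((p : ℕ) : 𝓞 ℚ) ∉ v.asIdeal ∧ W.HasGoodReductionAt v)
  (v₀ : HeightOneSpectrum (𝓞 ℚ)) (hv₀ : v₀ ∉ S) (vp : HeightOneSpectrum (𝓞 ℚ)) (hvp : ((p : ℕ) : 𝓞 ℚ) ∈ vp.asIdeal)

include hκ hord hS hv₀ hvp in
/-- **(HB6) at level zero, reduced form: `r_* b = 0`, hence `cor (r_* b) = 0`.** See the module docstring for the statement and the
four-step cocycle proof. The constant is `c = m + j₀` (`m` from `exists_pow_nsmul_push_eq_zero`, `j₀` from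
`exists_pow_nsmul_mem_localKernelOfReduction_of_forall_smul_sub_mem` at `p`); hypothesis `hT1` is (T₁).
[cite: GreenbergLNM1716, §2 Props. 2.1–2.4 (pp. 70–80), §3 Lemma 3.1 (p. 86), §4 Lemma 4.6 (p. 105)] [cite: SilvermanAEC2009, Prop. VII.3.1] -/
theorem exists_cores_reduce_eq_zero [Finite (W.selmerGroupPInfty p)]
    (hT1 : ∀ P : W.geomPoints, (∀ σ : absoluteGaloisGroup ℚ, σ • P = P) → (∃ t : ℕ, p ^ t • P = 0) →
      pointsMap W (vp.adicCompletion ℚ) P ∈ W.localKernelOfReduction vp → P = 0) :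
    ∃ c : ℕ, ∀ (j N : ℕ), c + j ≤ N →
      ∀ [Fintype (absoluteGaloisGroup ℚ ⧸ κ.layerSubgroup 0)]
      {s : absoluteGaloisGroup ℚ ⧸ κ.layerSubgroup 0 → absoluteGaloisGroup ℚ}
      (hs : ∀ x : absoluteGaloisGroup ℚ ⧸ κ.layerSubgroup 0, (s x : absoluteGaloisGroup ℚ ⧸ κ.layerSubgroup 0) = x)
      (hs1 : s ((1 : absoluteGaloisGroup ℚ) : absoluteGaloisGroup ℚ ⧸ κ.layerSubgroup 0) = 1)
      [CompactSpace (absoluteGaloisGroup ℚ)]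
      (r : (W.torsionGaloisModule ((p ^ N : ℕ) : ℤ)).toContRepresentation →ⁱL
        (W.torsionGaloisModule ((p ^ j : ℕ) : ℤ)).toContRepresentation)
      (hr : ∀ P : W.geomTorsion ((p ^ N : ℕ) : ℤ),
        ((r P : W.geomTorsion ((p ^ j : ℕ) : ℤ)) : W.geomPoints) = ((p ^ (N - j) : ℕ) : ℤ) • (P : W.geomPoints))
      (b : W.torsionH1Over ((p ^ N : ℕ) : ℤ) (κ.layerSubgroup 0)),
      (∀ w : HeightOneSpectrum (𝓞 ℚ), w ∉ S → w ∉ ({v₀} : Finset (HeightOneSpectrum (𝓞 ℚ))) →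
        galoisCohomology.localization ((W.torsionGaloisModule ((p ^ N : ℕ) : ℤ)).coind (κ.layerSubgroup 0) (κ.isOpen_layerSubgroup 0))
            (Sum.inr w) 1
            (shapiroLift (W.torsionGaloisModule ((p ^ N : ℕ) : ℤ)).toTopRep (κ.layerSubgroup 0) (κ.isOpen_layerSubgroup 0) hs hs1 b) ∈
          unramifiedSubgroup (GaloisRep.toLocal w
            ((W.torsionGaloisModule ((p ^ N : ℕ) : ℤ)).coind (κ.layerSubgroup 0) (κ.isOpen_layerSubgroup 0))) 1) →
      b ∈ (W.kernelOfReductionLocalDatumTorsion ((p ^ N : ℕ) : ℤ) vp).strictKer (κ.layerSubgroup 0) →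
      cores (W.torsionGaloisModule ((p ^ j : ℕ) : ℤ)).toTopRep (κ.layerSubgroup 0) (κ.isOpen_layerSubgroup 0)
        (cohomologyMap (subgroupRepHom (toTopRepHom (W.torsionGaloisModule ((p ^ N : ℕ) : ℤ))
          (W.torsionGaloisModule ((p ^ j : ℕ) : ℤ)) r) (κ.layerSubgroup 0)) 1 b) = 0 := by
  obtain ⟨m, hm⟩ := exists_pow_nsmul_push_eq_zero W p κ hκ hord S hS v₀ hv₀ vp hvp
  have hgood : W.HasGoodReductionAt vp := (W.hasGoodReductionAt_and_hasUnitRootAt_of_rat hord.1 hord.2 vp hvp).1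
  obtain ⟨j₀, hj₀⟩ := exists_pow_nsmul_mem_localKernelOfReduction_of_forall_smul_sub_mem W vp p hgood
  refine ⟨m + j₀, fun j N hN _ s hs hs1 _ r hr b hunr hstrict ↦ ?_⟩
  -- the reduced class already vanishes in `H¹(Γ_0, E[p^j])`
  suffices h0 : cohomologyMap (subgroupRepHom (toTopRepHom (W.torsionGaloisModule ((p ^ N : ℕ) : ℤ))
      (W.torsionGaloisModule ((p ^ j : ℕ) : ℤ)) r) (κ.layerSubgroup 0)) 1 b = 0 by
    rw [h0, map_zero]
  have hkill := hm N hs hs1 b hunr hstrict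
  obtain ⟨g, rfl⟩ := oneCocycleClass_surjective (discreteTopRep (κ.layerSubgroup 0) (W.geomTorsion ((p ^ N : ℕ) : ℤ))) b
  -- (1) `p^m g = ∂Q`, `Q ∈ E[p^∞]`
  obtain ⟨Q, hQ⟩ := exists_eq_smul_sub_of_nsmul_push_eq_zero W p (κ.layerSubgroup 0)
    (AcSigned.geomTorsion_zpow_le_geomPrimaryTorsion W p N : W.geomTorsion ((p ^ N : ℕ) : ℤ) ≤ W.geomPrimaryTorsion p) (p ^ m) g hkill
  -- (2) strictness at `p`: `m_N`
  obtain ⟨mN, hmN⟩ := exists_sub_mem_localKernelOfReduction_of_mem_strictKer W p (κ.layerSubgroup 0) N vp g hstrict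
  -- scalar bookkeeping on `E(ℚ̄)` (everything in `ℕ`-multiples)
  set Qp : W.geomPoints := (Q : W.geomPoints) with hQp
  set mp : W.geomPoints := ((mN : W.geomTorsion ((p ^ N : ℕ) : ℤ)) : W.geomPoints) with hmp
  have hsm : ∀ (σ : absoluteGaloisGroup ℚ) (n : ℕ) (x : W.geomPoints), σ • (n • x) = n • (σ • x) :=
    fun σ n x ↦ map_nsmul (DistribSMul.toAddMonoidHom W.geomPoints σ) n x
  have hpp : ∀ (a c : ℕ) (x : W.geomPoints), p ^ a • (p ^ c • x) = p ^ (a + c) • x :=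
    fun a c x ↦ by rw [← mul_nsmul', ← pow_add]
  have hQn : ∀ σ : κ.layerSubgroup 0,
      p ^ m • ((g.1 σ : W.geomTorsion ((p ^ N : ℕ) : ℤ)) : W.geomPoints) = (σ : absoluteGaloisGroup ℚ) • Qp - Qp :=
    fun σ ↦ by rw [← natCast_zsmul]; exact hQ σ
  have hgN : ∀ σ : κ.layerSubgroup 0, p ^ N • ((g.1 σ : W.geomTorsion ((p ^ N : ℕ) : ℤ)) : W.geomPoints) = 0 :=
    fun σ ↦ by rw [← natCast_zsmul]; exact (mem_geomTorsion_iff W _ _).mp (g.1 σ).2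
  have hmNN : p ^ N • mp = 0 := by rw [← natCast_zsmul]; exact (mem_geomTorsion_iff W _ _).mp mN.2
  obtain ⟨tQ, htQ⟩ := (PrimaryCoinvariants.mem_primaryComponent_iff_exists_nsmul p Qp).1 Q.2
  -- (2') `R := Q − p^m m_N` is `Γ_{ℚ_p}`-invariant modulo `E₁(ℚ̄_p)`, hence `p^{j₀} R ∈ E₁`
  set R : W.geomPoints := Qp - p ^ m • mp with hR
  have hRinv : ∀ τ : absoluteGaloisGroup (vp.adicCompletion ℚ),
      τ • pointsMap W (vp.adicCompletion ℚ) R - pointsMap W (vp.adicCompletion ℚ) R ∈ W.localKernelOfReduction vp := by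
    intro τ
    have hτ : absGaloisRestrict ℚ (vp.adicCompletion ℚ) τ ∈ κ.layerSubgroup 0 := mem_layerSubgroup_zero p κ _
    have hps : pointsMap W (vp.adicCompletion ℚ) (absGaloisRestrict ℚ (vp.adicCompletion ℚ) τ • R) =
        τ • pointsMap W (vp.adicCompletion ℚ) R := pointsMap_smul W _ τ _
    have hQ' := hQn ⟨_, hτ⟩
    have hdiff : absGaloisRestrict ℚ (vp.adicCompletion ℚ) τ • R - R =
        p ^ m • ((g.1 ⟨absGaloisRestrict ℚ (vp.adicCompletion ℚ) τ, hτ⟩ -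
          (absGaloisRestrict ℚ (vp.adicCompletion ℚ) τ • mN - mN) : W.geomTorsion ((p ^ N : ℕ) : ℤ)) : W.geomPoints) := by
      rw [AddSubgroupClass.coe_sub, AddSubgroupClass.coe_sub, Literature.NumberTheory.EllipticCurves.AddSubgroup.torsionBy.coe_smul,
        nsmul_sub, hQ', hR, smul_sub, hsm, nsmul_sub]
      abel
    rw [← hps, ← map_sub, hdiff, map_nsmul]
    exact AddSubgroup.nsmul_mem _ (hmN τ hτ) _
  have hRtors : ∃ t : ℕ, p ^ t • pointsMap W (vp.adicCompletion ℚ) R = 0 := by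
    refine ⟨N + tQ, ?_⟩
    have h1 : p ^ (N + tQ) • Qp = 0 := by rw [← hpp, htQ, nsmul_zero]
    have h2 : p ^ (N + tQ) • (p ^ m • mp) = 0 := by rw [← hpp N tQ, hpp tQ m, ← mul_nsmul', mul_comm, mul_nsmul', hmNN, nsmul_zero]
    rw [← map_nsmul (pointsMap W (vp.adicCompletion ℚ)), hR, nsmul_sub, h1, h2, sub_zero, map_zero]
  have hRE1 : p ^ j₀ • pointsMap W (vp.adicCompletion ℚ) R ∈ W.localKernelOfReduction vp :=
    hj₀ (pointsMap W (vp.adicCompletion ℚ) R) hRinv hRtors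
  -- (3) `P := p^{N-m} Q` is `Γ_ℚ`-invariant, `p`-power torsion and lands in `E₁`: `P = 0`
  have hNm : (N - m) + m = N := Nat.sub_add_cancel (by omega)
  have hPzero : p ^ (N - m) • Qp = 0 := by
    refine hT1 _ (fun σ ↦ ?_) ⟨tQ, ?_⟩ ?_
    · -- invariance: `σ P − P = p^{N-m}(σQ − Q) = p^{N-m} p^m g(σ) = p^N g(σ) = 0`
      rw [← sub_eq_zero, hsm, ← nsmul_sub, ← hQn ⟨σ, mem_layerSubgroup_zero p κ σ⟩, hpp, hNm]
      exact hgN _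
    · rw [hpp, add_comm, ← hpp, htQ, nsmul_zero]
    · -- `P = p^{N-m-j₀} (p^{j₀} R) + p^N m_N` locally
      have h3 : p ^ (N - m) • (p ^ m • mp) = 0 := by rw [hpp, hNm, hmNN]
      have hsplit : p ^ (N - m) • Qp = p ^ (N - m - j₀) • (p ^ j₀ • R) := by
        rw [hpp, show N - m - j₀ + j₀ = N - m by omega, hR, nsmul_sub, h3, sub_zero]
      rw [hsplit, map_nsmul, map_nsmul]
      exact AddSubgroup.nsmul_mem _ hRE1 _
  -- (4) `r_* [g] = [p^{N-j} g] = [∂ (p^{N-j-m} Q)]` with `p^{N-j-m} Q ∈ E[p^j]`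
  have hy : p ^ (N - m - j) • Qp ∈ W.geomTorsion ((p ^ j : ℕ) : ℤ) := by
    rw [mem_geomTorsion_iff, natCast_zsmul, hpp, show j + (N - m - j) = N - m by omega]
    exact hPzero
  refine (cohomologyMap_oneCocycleClass
    (A := subgroupRep (W.torsionGaloisModule ((p ^ N : ℕ) : ℤ)).toTopRep (κ.layerSubgroup 0)) _ g).trans ?_
  rw [oneCocycleClass_eq_zero_iff]
  refine ⟨⟨_, hy⟩, fun σ ↦ Subtype.ext ?_⟩
  rw [pullback_id_resIdHom_apply, subgroupRepHom_hom_apply, subgroupRep_ρ_apply, ContinuousRep.toTopRep_ρ_apply,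
    torsionGaloisModule_apply_apply]
  change ((r (g.1 σ) : W.geomTorsion ((p ^ j : ℕ) : ℤ)) : W.geomPoints) =
    (((σ : absoluteGaloisGroup ℚ) • (⟨_, hy⟩ : W.geomTorsion ((p ^ j : ℕ) : ℤ)) - ⟨_, hy⟩ : W.geomTorsion ((p ^ j : ℕ) : ℤ)) :
      W.geomPoints)
  rw [hr, natCast_zsmul, AddSubgroupClass.coe_sub, Literature.NumberTheory.EllipticCurves.AddSubgroup.torsionBy.coe_smul, hsm,
    ← nsmul_sub]
  change p ^ (N - j) • ((g.1 σ : W.geomTorsion ((p ^ N : ℕ) : ℤ)) : W.geomPoints) =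
    p ^ (N - m - j) • ((σ : absoluteGaloisGroup ℚ) • Qp - Qp)
  rw [← hQn σ, hpp, show N - m - j + m = N - j by omega]

end Main

end TorsionEulerChar.H46LevelZero

end Summit.BirchSwinnertonDyer.BirchSwinnertonDyer.Theorems
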